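import Summits.ResolutionOfSingularities.ResolutionOfSingularities.Theses.UniversalCells
import Summits.ResolutionOfSingularities.ResolutionOfSingularities.Theorems.WeightedInvariantDescentReducedToIntegral
import HarnessLib

/-!
# Crux `PrimeFieldToPerfect` (stmt-ResolutionOfSingularities-15233) — line `frobenius-root-climb`

Strategist line (planner-cstrat-stmt-ResolutionOfSingularities-15233-b1-0, 2026-08-17), written
ALONGSIDE the lead's registered skeleton `Lines/birth.lean` (reshape 1: stubs `stub_spreadOut`,
`stub_smoothTwist` = the open kernel `SmoothTwist p`, `stub_limitDescent` (landed p148751),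
`stub_separableDescent`). Same crux, concluded BY NAME; a DIFFERENT CUT of the open kernel.

## The cut: climb ONE transcendental at a time over a PERFECT constant field

The lead's kernel `SmoothTwist p` lives over a finitely generated field `K` of characteristic `p`
(transcendence degree `e`, p-basis of size `e`, total spaces of finite type over `𝔽_p`). This line
normalises the kernel to its atomic form:

* `stub_climb` — **THE OPEN KERNEL, normal form (open-problem sized).** For a PERFECT field `M` of
  characteristic `p` over which every integral separated scheme of finite type is resolvable (ALL
  dimensions), and a perfect field `L ⊇ M` of "perfect transcendence degree ≤ 1" over `M` (some
  `t ∈ L` with `L` algebraic over `M(t)`; the live case is `L = M(t)^{perf}`), every integral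
  separated `L`-scheme of finite type is resolvable. Why this is the right workbench (line card
  `Lines/frobenius-root-climb.md`): an `L`-variety descends to `K = M(t^{p^{-n}}) ≅ M(t)` and spreads
  out to a fibration `f : 𝒱 → U ⊆ 𝔸¹_M` whose total space, resolved over `M` by the hypothesis, is
  SMOOTH over `M` (regular over perfect = smooth, in tree
  `Literature.AlgebraicGeometry.Resolution.smooth_of_isRegular_of_perfectField`); one step of the
  purely inseparable tower `K ⊂ K^{1/p} ⊂ …` is then the FROBENIUS ROOT of the function `f`: the
  `α_p`-torsor `𝒱[f^{1/p}] = 𝒱 ×_{𝔸¹,F} 𝔸¹ → 𝒱` (a Zariski hypersurface `σ^p = f` over a smooth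
  variety — the object of Valuative's crux `LuAlphaPTorsor`, stmt-0641, here with its resolution over
  `M` available FOR FREE from the hypothesis), whose normalisation is the quotient of `𝒱` by the
  p-closed foliation `ker df` (Patakfalvi–Waldron arXiv:1708.04268 §2.4 and Thm 3.1; Ekedahl 1987)
  and carries the canonical derivation `D = 1 ⊗ ∂_s`, `D(s) = 1`, `D^p = 0`; the generic fibre over
  `M(s) = K^{1/p}` is SMOOTH exactly where `ds` is unimodular (submersion lemma, Sketch.lean of this
  seat). What remains open is TERMINATION of root-extraction + re-resolution, i.e. an invariant —
  Tate's genus drop is the `d = 1` instance (P–W Thm 1.1: conductor divisible by `p − 1` is its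
  codimension-one shadow in all dimensions).
* `stub_tower` — **finitely generated fields are reached by finitely many climbs (TRUE, size M).**
  From resolution over `𝔽_p = ZMod p` and the climb, resolution over every perfect `L` purely
  inseparable over a finitely generated `K` (= `PerfectClosureRes p`, the SAME intermediate target
  as the lead's `stub_limitDescent ∘ stub_smoothTwist ∘ stub_spreadOut`). Paper proof: let
  `s = {t₁,…,t_e}` generate `K` as a field; put `M₀ := 𝔽_p` and `M_i := perfectClosure 𝔽_p(t₁,…,t_i) L`
  (Mathlib `perfectClosure`, perfect because `L` is: `perfectClosure.perfectRing`); `M_{i+1}` is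
  purely inseparable over `𝔽_p(t₁,…,t_{i+1}) ⊆ M_i(t_{i+1})`, hence algebraic over `M_i(t_{i+1})`, so
  the climb applies `e` times; finally `L` is purely inseparable over `K ⊆ M_e`, hence algebraic over
  `M_e = M_e(0)`, and the climb applies once more (degenerate `t`). No transcendence bases, no
  separating elements: pure `IntermediateField`/`perfectClosure` bookkeeping plus `e + 1`
  applications of the climb. NO base change of a resolution occurs anywhere in this stub.
* `stub_separableDescent` — **perfect closures of finitely generated fields ⇒ all perfect fields
  (TRUE, size M)** — VERBATIM the lead's registered stub of the same name (identical unfolded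
  signature), so that its proof serves both lines: finite-type descent `Theorems.stub_fgModel` +
  `perfectClosure K₀ k` + smooth base change along the SEPARABLE `perfectClosure K₀ k → k`.
* Reduced ⇒ integral over the fixed perfect `k`: the landed
  `Theorems.descentReducedToIntegral_proof` (stmt-0551), used in the composition.
* `PrimeFieldToPerfect_of : Sig.stub_climb → Sig.stub_tower → Sig.stub_separableDescent →
  PrimeFieldToPerfect` is PROVED (pure logic + the landed reduction); `PrimeFieldToPerfect_proof`
  plugs the three `stub_*` in (their unfolded signatures are definitionally the `Sig.*`).

Disproof used: none on file (no `Disproof.lean` for this crux, `ledger crux ls` 2026-08-17; refuter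
crux-attack rattack-15233-0: SURVIVES, `S → C` proved, `IsReduced`/`IsIntegral` load-bearing — both
kept verbatim here: the conclusion is reached for reduced `X` through the landed reduced ⇒ integral
theorem, the hypothesis is used with `IsIntegral`). Barrier witnesses
(`InseparableBaseChangeResolution`, `RegularNotGeometricallyRegular`, `FrobeniusTwistResolution`):
no stub base-changes a resolution along an inseparable extension — `stub_tower` makes no base change
at all, `stub_separableDescent` only along the separable `K₀^{perf} → k`, and `stub_climb` asks for
resolutions over the perfect `L` itself.
-/

noncomputable section

-- single-problem summit: the doubled namespace component `ResolutionOfSingularities` is forced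
set_option linter.dupNamespace false

open CategoryTheory CategoryTheory.Limits AlgebraicGeometry Literature.AlgebraicGeometry.Resolution
open Summit.ResolutionOfSingularities.ResolutionOfSingularities.Theses.UniversalCells (PrimeFieldToPerfect)

namespace Summit.ResolutionOfSingularities.ResolutionOfSingularities.Cruxes.PrimeFieldToPerfect.Lines.FrobeniusRootClimb

/-! ## The predicates of the cut (the first four are letter-for-letter those of `Lines/birth.lean`) -/

/-- **Resolution of integral separated schemes of finite type over `Spec R`** — for `R = ZMod p`
verbatim the hypothesis of the crux; for a field `R = K` verbatim the hypothesis of the landed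
`WeightedInvariant.DescentReducedToIntegral`. [cite: Kollar2007, Ch. 3 (the problem in char p)] -/
def IntegralResOver (R : Type) [CommRing R] : Prop :=
  ∀ (X : Scheme.{0}) (f : X ⟶ Spec (.of R)), IsSeparated f → LocallyOfFiniteType f →
    QuasiCompact f → IsIntegral X → Scheme.HasResolution X

/-- **`K` is a finitely generated field** (over its prime field). [folklore] -/
def FieldFG (K : Type) [Field K] : Prop :=
  ∃ s : Finset K, Subfield.closure (s : Set K) = ⊤

/-- **Resolution over the perfect closures of finitely generated fields of characteristic `p`**
(integral separated schemes of finite type) — the intermediate target shared with line `birth`.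
[cite: Kollar2007, 1.19 (Curves over nonperfect fields)] -/
def PerfectClosureRes (p : ℕ) : Prop :=
  ∀ (K : Type) [Field K] [CharP K p], FieldFG K →
    ∀ (L : Type) [Field L] [PerfectField L] [Algebra K L] [IsPurelyInseparable K L],
      IntegralResOver L

/-- **Resolution of integral separated schemes of finite type over every perfect field of
characteristic `p`** — the integral case of the crux's conclusion. [folklore] -/
def PerfectRes (p : ℕ) : Prop :=
  ∀ (k : Type) [Field k] [CharP k p] [PerfectField k], IntegralResOver k

/-- **`Climb p` — THE OPEN KERNEL in normal form: one transcendental over a perfect constant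
field.** For every perfect field `M` of characteristic `p` with `IntegralResOver M` (all
dimensions!) and every perfect field `L` of characteristic `p` over `M` containing an element `t`
with `L` algebraic over `M(t)` (live case `L = M(t)^{perf}`; degenerate cases `L/M` algebraic),
`IntegralResOver L`. Implied by the summit; for `dim ≤ 3` true unconditionally (CossartPiltant2019);
equivalent, modulo the true `stub_tower`/`stub_separableDescent` and spreading out, to the lead's
`SmoothTwist p`. Why it might fail / why open: at every finite level `M(t^{p^{-n}}) ≅ M(t)` the
hypothesis only yields REGULAR models (generic fibres of smooth `M`-total spaces), regular ⇏ smooth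
(`Literature.Barriers.ResolutionOfSingularities.RegularNotGeometricallyRegular`), and the
root-extraction tower `𝒱 ↦ res(𝒱[f^{1/p}])` has no termination argument in print beyond curves
(Tate genus change). [cite: arXiv:1708.04268, Thm 1.1 and §2.4 (Patakfalvi–Waldron)] -/
def Climb (p : ℕ) : Prop :=
  ∀ (M : Type) [Field M] [CharP M p] [PerfectField M], IntegralResOver M →
    ∀ (L : Type) [Field L] [CharP L p] [PerfectField L] [Algebra M L] (t : L),
      Algebra.IsAlgebraic (IntermediateField.adjoin M ({t} : Set L)) L → IntegralResOver L

/-! ## Sanity (proved): the kernel's conclusion is a special case of the crux's — the cut loses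
nothing (`Climb p` follows from `PerfectRes p` by forgetting `M` and `t`). -/

/-- Resolution over all perfect fields of characteristic `p` gives the climb outright. [folklore] -/
theorem climb_of_perfectRes {p : ℕ} (h : PerfectRes p) : Climb p := by
  intro M _ _ _ _ L _ _ _ _ _ _
  exact h L

/-! ## The stub STATEMENTS by name (`Sig.stub_<name>`); the registered-style `stub_*` theorems
below state the SAME propositions with every file-local predicate unfolded. -/

/-- Statement of `stub_climb`: the kernel in normal form, prime by prime. [cite: arXiv:1708.04268, Thm 1.1] -/
def Sig.stub_climb : Prop :=
  ∀ p : ℕ, p.Prime → Climb p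

/-- Statement of `stub_tower`: prime field + climb ⇒ perfect closures of finitely generated fields.
[cite: EGAIV3, Thm. 8.8.2 (ii)] -/
def Sig.stub_tower : Prop :=
  ∀ p : ℕ, p.Prime → IntegralResOver (ZMod p) → Climb p → PerfectClosureRes p

/-- Statement of `stub_separableDescent` (shared verbatim with line `birth`): perfect closures of
finitely generated fields ⇒ all perfect fields. [cite: Liu2002, Prop. 3.2.7 and Cor. 4.3.33] -/
def Sig.stub_separableDescent : Prop :=
  ∀ p : ℕ, p.Prime → PerfectClosureRes p → PerfectRes p

/-! ## The stubs (every file-local predicate unfolded) -/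

/-- **STUB (THE OPEN KERNEL, normal form; open-problem sized).** One transcendental over a perfect
constant field: `M` perfect of characteristic `p` with resolution of all integral separated
finite-type `M`-schemes, `L ⊇ M` perfect of characteristic `p`, `t ∈ L` with `L` algebraic over
`M(t)` ⇒ resolution of all integral separated finite-type `L`-schemes. Workbench: spread an
`L`-variety out to `f : 𝒱 → U ⊆ 𝔸¹_M` with `𝒱` SMOOTH over `M`; one Frobenius step = the
`α_p`-torsor / Zariski hypersurface `𝒱[f^{1/p}]`, normalisation = quotient by the foliation
`ker df`, canonical derivation `D(s) = 1`; open: termination of root-extraction + re-resolution.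
[cite: arXiv:1708.04268, Thm 1.1 and §2.4 (Patakfalvi–Waldron)] -/
theorem stub_climb (p : ℕ) (hp : p.Prime)
    (M : Type) [Field M] [CharP M p] [PerfectField M]
    (hM : ∀ (X : Scheme.{0}) (f : X ⟶ Spec (.of M)), IsSeparated f → LocallyOfFiniteType f →
      QuasiCompact f → IsIntegral X → Scheme.HasResolution X)
    (L : Type) [Field L] [CharP L p] [PerfectField L] [Algebra M L] (t : L)
    (ht : Algebra.IsAlgebraic (IntermediateField.adjoin M ({t} : Set L)) L)
    (X : Scheme.{0}) (f : X ⟶ Spec (.of L)) (hs : IsSeparated f) (hl : LocallyOfFiniteType f)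
    (hq : QuasiCompact f) (hX : IsIntegral X) : Scheme.HasResolution X := by
  sorry

/-- **STUB (true, size M).** The tower: with `s = {t₁,…,t_e}` generating the finitely generated
`K` and `L ⊇ K` perfect purely inseparable, climb along `M₀ = 𝔽_p`,
`M_i = perfectClosure 𝔽_p(t₁,…,t_i) L` (perfect: `perfectClosure.perfectRing`; `M_{i+1}` algebraic
over `M_i(t_{i+1})` because purely inseparable over `𝔽_p(t₁,…,t_{i+1})`), then once more from
`M_e` to `L` (algebraic, `t := 0`). No base change of any resolution. [cite: EGAIV3, Thm. 8.8.2 (ii)] -/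
theorem stub_tower (p : ℕ) (hp : p.Prime)
    (h₀ : ∀ (X : Scheme.{0}) (f : X ⟶ Spec (.of (ZMod p))), IsSeparated f → LocallyOfFiniteType f →
      QuasiCompact f → IsIntegral X → Scheme.HasResolution X)
    (hc : ∀ (M : Type) [Field M] [CharP M p] [PerfectField M],
      (∀ (X : Scheme.{0}) (f : X ⟶ Spec (.of M)), IsSeparated f → LocallyOfFiniteType f →
        QuasiCompact f → IsIntegral X → Scheme.HasResolution X) →
      ∀ (L : Type) [Field L] [CharP L p] [PerfectField L] [Algebra M L] (t : L),
        Algebra.IsAlgebraic (IntermediateField.adjoin M ({t} : Set L)) L →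
        ∀ (X : Scheme.{0}) (f : X ⟶ Spec (.of L)), IsSeparated f → LocallyOfFiniteType f →
          QuasiCompact f → IsIntegral X → Scheme.HasResolution X)
    (K : Type) [Field K] [CharP K p] (hK : ∃ s : Finset K, Subfield.closure (s : Set K) = ⊤)
    (L : Type) [Field L] [PerfectField L] [Algebra K L] [IsPurelyInseparable K L]
    (X : Scheme.{0}) (f : X ⟶ Spec (.of L)) (hs : IsSeparated f) (hl : LocallyOfFiniteType f)
    (hq : QuasiCompact f) (hX : IsIntegral X) : Scheme.HasResolution X := by
  sorry

/-- **STUB (true, size M) — shared verbatim with line `birth`.** Separable descent: an integral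
separated finite-type `X` over a perfect `k` descends to a finitely generated `K₀ ⊆ k`
(`Theorems.stub_fgModel`); with `L := perfectClosure K₀ k` (perfect, purely inseparable over `K₀`)
the base change `X₀ ×_{K₀} L` is integral, the hypothesis resolves it, the resolution is regular of
finite type over the PERFECT `L`, hence smooth (`smooth_of_isRegular_of_perfectField`), so its base
change along the SEPARABLE `L → k` is smooth, hence regular, proper and birational over `X`
(`Theorems.stub_resolutionOfRobustModel`). [cite: Liu2002, Prop. 3.2.7 and Cor. 4.3.33] -/
theorem stub_separableDescent (p : ℕ) (hp : p.Prime)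
    (h : ∀ (K : Type) [Field K] [CharP K p], (∃ s : Finset K, Subfield.closure (s : Set K) = ⊤) →
      ∀ (L : Type) [Field L] [PerfectField L] [Algebra K L] [IsPurelyInseparable K L]
        (X : Scheme.{0}) (f : X ⟶ Spec (.of L)), IsSeparated f → LocallyOfFiniteType f →
          QuasiCompact f → IsIntegral X → Scheme.HasResolution X)
    (k : Type) [Field k] [CharP k p] [PerfectField k]
    (X : Scheme.{0}) (f : X ⟶ Spec (.of k)) (hs : IsSeparated f) (hl : LocallyOfFiniteType f)
    (hq : QuasiCompact f) (hX : IsIntegral X) : Scheme.HasResolution X := by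
  sorry

/-! ## The compositions (kernel-checked; no `sorry` in their own terms) -/

/-- `PerfectClosureRes p` from the prime-field hypothesis through the climb and the tower.
[folklore] -/
theorem perfectClosureRes_of (h₁ : Sig.stub_climb) (h₂ : Sig.stub_tower) :
    ∀ p : ℕ, p.Prime → IntegralResOver (ZMod p) → PerfectClosureRes p :=
  fun p hp h₀ => h₂ p hp h₀ (h₁ p hp)

/-- **`PrimeFieldToPerfect` from the three stub statements** — the assembly, PROVED: fix `p`;
the crux hypothesis is `IntegralResOver (ZMod p)` on the nose; climb + tower give
`PerfectClosureRes p`, separable descent gives `PerfectRes p`, and the landed reduced ⇒ integral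
reduction `Theorems.descentReducedToIntegral_proof` (stmt-0551) finishes for reduced `X/k`.
[folklore] -/
theorem PrimeFieldToPerfect_of :
    Sig.stub_climb → Sig.stub_tower → Sig.stub_separableDescent → PrimeFieldToPerfect := by
  intro h₁ h₂ h₃ p hp hF k _ _ _ X f hs hl hq hr
  have hPerf : PerfectRes p := h₃ p hp (perfectClosureRes_of h₁ h₂ p hp hF)
  have hInt : ∀ (Y : Scheme.{0}) (g : Y ⟶ Spec (.of k)), IsSeparated g → LocallyOfFiniteType g →
      QuasiCompact g → IsIntegral Y → Scheme.HasResolution Y :=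
    fun Y g hs' hl' hq' hint => hPerf k Y g hs' hl' hq' hint
  exact _root_.Summit.ResolutionOfSingularities.ResolutionOfSingularities.Theorems.descentReducedToIntegral_proof
    k hInt X f hs hl hq hr

/-- **The crux `PrimeFieldToPerfect`, assembled from the three stubs** (the skeleton theorem:
`PrimeFieldToPerfect_of` with the `stub_*` plugged in; the only `sorry`s in its closure are the
stubs). -/
theorem PrimeFieldToPerfect_proof : PrimeFieldToPerfect :=
  PrimeFieldToPerfect_of
    (fun p hp M _ _ _ hM L _ _ _ _ t ht X f hs hl hq hX =>
      stub_climb p hp M hM L t ht X f hs hl hq hX)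
    (fun p hp h₀ hc K _ _ hK L _ _ _ _ X f hs hl hq hX =>
      stub_tower p hp h₀ (fun M _ _ _ hM L _ _ _ _ t ht => hc M hM L t ht) K hK L X f hs hl hq hX)
    (fun p hp h k _ _ _ X f hs hl hq hX =>
      stub_separableDescent p hp (fun K _ _ hK L _ _ _ _ => h K hK L) k X f hs hl hq hX)

end Summit.ResolutionOfSingularities.ResolutionOfSingularities.Cruxes.PrimeFieldToPerfect.Lines.FrobeniusRootClimb

end
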